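import Literature.IUT.LogThetaLattice.FrobeniusChainNonVacuity
import Literature.IUT.LogThetaLattice.CoricNonVacuity
import Literature.IUT.LogThetaLattice.LatticeGlueOfKits
import Literature.IUT.LogThetaLattice.StripFrameOfKitsToy
import Mathlib.Data.Fintype.Pi
import Mathlib.Data.Finite.Prod
import Mathlib.Logic.Function.Basic
import HarnessLib

/-!
# [IUTchIII] Prop 1.2 (x) / Cor 2.3 — the NV-L6 rows «FrobeniusChain» and «Coric» AT THE FRAME ASSEMBLED FROM THE KITS
# (`StripFrame.ofKits`): the `Infinite FK.FStrip` clause DECIDED kit by kit, and `Coric` inhabited unconditionally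

Mochizuki, *Inter-universal Teichmüller Theory III*, kurims manuscript (May 2020), Prop 1.2 (x) p. 34 ("a collection
of distinct `F`-prime-strips … indexed by the integers"), Cor 2.3 p. 73 ("coric data `†ℭ = (†𝔇^⊢, F^{⊢×μ}(†𝔇^⊢))`");
*I* (May 2020) Def 4.1 (iii)(iv) p. 96 (`𝒟^⊢`-prime-strips, the tautological one), Def 5.2 (i)(iii) p. 134
(`ℱ`-prime-strips `‡𝔉 = {‡ℱ_v}_{v∈𝕍}`, each `‡ℱ_v` an isomorph of the model `ℱ_v`), Def 6.4 (iii) p. 163 (the model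
`𝒟-Θ^{±ell}`-Hodge theater of Examples 6.2, 6.3). PROOF-ONLY companion (no `def`, no `instance`, no `structure`) of
abc-iut-w5-d197's `FrobeniusChainNonVacuity.lean` / `CoricNonVacuity.lean`, which left the GENUINE-frame instances as
criteria (`FrobeniusChain.nonempty_iff_of_F_eq_asSmall`: chain iff `Infinite FK.FStrip`; `Coric.nonempty_iff_of_dv_eq_asSmall`:
coric datum iff `Nonempty M.DMono`) "which this file does not decide". This file decides them (L6-lead DISCHARGE-L6 v1.18
STATE 03:46Z, OPEN NAMED WORK (2): «FrobeniusChain ↔ Infinite FK.FStrip at StripFrame.ofKits — decide `Infinite` for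
abc-iut-L5-t4's kit; Coric at ofKits»):

* KIT LEVEL (abc-iut-L5-t4's `PMBaseKit.FKit`, [IUTchI] Def 5.2 (i)): an `ℱ`-prime-strip is determined by its constituents
  (`FKit.FStrip.obj_injective`; the "is an isomorph of `ℱ_v`" clause is a proposition), so
  - `FKit.FStrip.finite_of_finite`: finitely many places and finitely many objects in each ambient category `FAmb v` ⇒
    finitely many `ℱ`-prime-strips;
  - `FKit.FStrip.infinite_iff_subtype`: `Infinite FK.FStrip` iff the families `{‡ℱ_v}_v` of model-isomorphs form an
    infinite type; `FKit.FStrip.infinite_of_place`: ONE place `v` whose ambient category holds infinitely many isomorphs of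
    `ℱ_v` suffices (vary `‡ℱ_v`, keep the model elsewhere).
* FRAME LEVEL (abc-iut-L6-t3's `StripFrame.ofKits L hbij hsurj hR X`, [IUTchIII] Def 1.1):
  `FrobeniusChain.nonempty_ofKits_iff` (chain iff `Infinite FK.FStrip`, the criterion instantiated by `rfl`),
  `FrobeniusChain.isEmpty_ofKits_of_finite` (NEGATIVE for every kit with finitely many places and finite ambient
  categories), `FrobeniusChain.nonempty_ofKits_of_place` (POSITIVE from one place with infinitely many model-isomorphs).
* THE DECISION AT THE LANDED CONCRETE KIT — abc-iut-L5-t4's TOY kit `FKit.toy l hl` (one place, ambient category the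
  two-object collage category `Model.Obj l = {loc, glob}`, [IUTchI] Def 6.1 model plumbing) under abc-iut-L6-t3's toy frame
  `KitsToy.frame l hl = StripFrame.ofKits (MonoLaws.toy) … (KitsToy.timesMuSide)` (`StripFrameOfKitsToy.lean`):
  `KitsToy.fStrip_obj_eq_loc` (every `ℱ`-prime-strip of the toy kit IS the model strip: `glob` is not an isomorph of `loc`),
  `KitsToy.subsingleton_fStrip`, `KitsToy.finite_fStrip`, hence **`KitsToy.isEmpty_frobeniusChain : IsEmpty (FrobeniusChain
  (KitsToy.frame l hl))`** — the only `StripFrame.ofKits` instance in the tree carries NO Frobenius-picture chain (exactly as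
  abc-iut-L6-t3's `Witness.twoFrame`, `FrobeniusChain.isEmpty_twoFrame`): the theorems of `LogLink.lean` quantified over
  `P : FrobeniusChain S` remain instantiated only at abc-iut-w5-d197's degenerate `ℤ`-labelled frame
  (`FrobeniusChain.nonempty_degenerate`). For the ABSTRACT kits of record (`FKitLink.toFKit` of
  `HodgeTheaterModelFKit.lean`: `FAmb := L.LocC`, the KIND of `𝒞_v`, a hypothesis-structure field) the clause is exactly
  `infinite_of_place` / `finite_of_finite` applied to that kind — CONDITIONAL on the kind, not decidable here; in print the
  ambient "category of isomorphs of `ℱ_v`" is a proper class, so `Infinite` is the intended reading and the toy's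
  finiteness is a DISCLOSED TRUNCATION of the toy, not a finding about the series.
* `Coric` AT `ofKits` — UNCONDITIONAL: `Coric.nonempty_ofKits (E) : Nonempty (Coric E)` for EVERY `ThetaCoricData E` over
  `StripFrame.ofKits …` (the mono-analyticisation `M.mono (DStrip.model K)` of the tautological `𝒟`-prime-strip, [IUTchI]
  Def 4.1 (iv) / Ex 6.2 (i), is a `𝒟^⊢`-prime-strip of the kit — `MultKit.nonempty_dMono`), in particular for abc-iut-L6-t3's
  `ThetaCoricData.ofKits L hbij hsurj hR X Ck` (`Coric.nonempty_ofKits_coricKit`, p419606); and the PRINTED producer route of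
  Cor 2.3 (`†ℜ ↦ †ℭ`, `radialAlgorithm`) is available there too: `StripFrame.nonempty_DHT_ofKits` (the model `𝒟-Θ^{±ell}`-Hodge
  theater `Ex62.ht` of [IUTchI] Examples 6.2/6.3 is an object of `DHTRep K`, for `l ≠ 0`), `Radial.nonempty_ofKits`,
  `Coric.nonempty_ofKits_of_radial`, `Coric.exists_iso_radialAlgorithm_obj_ofKits` (every coric datum over `ofKits` is
  isomorphic to one produced by the radial algorithm — Cor 2.3 (i) essential surjectivity, landed `radialAlgorithm_essSurj`).
  At the toy frame: `KitsToy.nonempty_coric`.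

HONEST LABEL (L6-lead §F v1.18p (4)): `Coric` at `ofKits` is a GENUINE-frame inhabitant relative to the kits (no toy choice
made here: every kit, every `ThetaCoricData`); `FrobeniusChain` at `ofKits` is DECIDED NEGATIVELY at the toy kit and reduced
to the cardinality of the ambient kinds in general. Nothing of [IUTchIII] is asserted; a witness is consistency evidence
only; typed ≠ proved; no side is taken on [IUTchIII] Cor 3.12. [claim: Mochizuki2012, status: disputed]
-/

universe u

/-! ### 1. Kit level: how many `ℱ`-prime-strips does a kit have? ([IUTchI] Def 5.2 (i)) -/

namespace Literature.IUT.HodgeTheaters.PMBaseKit.FKit.FStrip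

open CategoryTheory

variable {l : ℕ} {K : PMBaseKit.{u} l} {M : K.MultKit} {FK : K.FKit M}

/-- **IUTchI:Def5.2(i)** (kurims p.134) An `ℱ`-prime-strip `‡𝔉 = {‡ℱ_v}_{v∈𝕍}` is determined by its constituents: the clause
"each `‡ℱ_v` admits an isomorphism to the model `ℱ_v`" is a proposition. [claim: Mochizuki2012, status: disputed] -/
theorem obj_injective : Function.Injective (FStrip.obj : FK.FStrip → ∀ v, FK.FAmb v) := by
  rintro ⟨a, ha⟩ ⟨b, hb⟩ (h : a = b)
  subst h
  rfl

/-- **IUTchI:Def5.2(i)** (kurims p.134) Two `ℱ`-prime-strips with the same constituents are equal.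
[claim: Mochizuki2012, status: disputed] -/
theorem ext_obj {F₁ F₂ : FK.FStrip} (h : F₁.obj = F₂.obj) : F₁ = F₂ :=
  obj_injective h

/-- **IUTchI:Def5.2(i)** (kurims p.134) The `ℱ`-prime-strips of a kit are in bijection with the families `{‡ℱ_v}_{v∈𝕍}` of
model-isomorphs (the record, unbundled). [claim: Mochizuki2012, status: disputed] -/
theorem nonempty_equiv_subtype :
    Nonempty (FK.FStrip ≃ {F : ∀ v, FK.FAmb v // ∀ v, Nonempty (F v ≅ FK.fModel v)}) :=
  ⟨{ toFun := fun F => ⟨F.obj, F.isModel⟩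
     invFun := fun F => ⟨F.1, F.2⟩
     left_inv := fun _ => rfl
     right_inv := fun _ => rfl }⟩

/-- **IUTchI:Def5.2(i)** (kurims p.134) A kit with finitely many places `𝕍` and finitely many objects in each ambient category
`FAmb v` has finitely many `ℱ`-prime-strips. [claim: Mochizuki2012, status: disputed] -/
theorem finite_of_finite [Finite K.V] [∀ v, Finite (FK.FAmb v)] : Finite FK.FStrip :=
  Finite.of_injective _ obj_injective

/-- **IUTchI:Def5.2(i)** (kurims p.134) CRITERION: a kit has infinitely many `ℱ`-prime-strips iff the families
`{‡ℱ_v}_{v∈𝕍}` of model-isomorphs form an infinite type. [claim: Mochizuki2012, status: disputed] -/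
theorem infinite_iff_subtype :
    Infinite FK.FStrip ↔ Infinite {F : ∀ v, FK.FAmb v // ∀ v, Nonempty (F v ≅ FK.fModel v)} :=
  (Classical.choice nonempty_equiv_subtype).infinite_iff

/-- **IUTchI:Def5.2(i)** (kurims p.134) SUFFICIENT CONDITION: if at ONE place `v` the ambient category `FAmb v` holds infinitely
many isomorphs of the model `ℱ_v`, the kit has infinitely many `ℱ`-prime-strips (vary `‡ℱ_v`, keep the model `ℱ_w` at
`w ≠ v`). In print the "category of isomorphs of `ℱ_v`" is a proper class; for the cell's kits this is a property of the
chosen ambient KIND. [claim: Mochizuki2012, status: disputed] -/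
theorem infinite_of_place (v : K.V) (h : Infinite {X : FK.FAmb v // Nonempty (X ≅ FK.fModel v)}) :
    Infinite FK.FStrip := by
  classical
  let ι : {X : FK.FAmb v // Nonempty (X ≅ FK.fModel v)} → FK.FStrip := fun X =>
    ⟨Function.update (fun w => FK.fModel w) v X.1, fun w => by
      by_cases hw : w = v
      · subst hw
        rw [Function.update_self]
        exact X.2
      · rw [Function.update_of_ne hw]
        exact ⟨Iso.refl _⟩⟩
  haveI := h
  refine Infinite.of_injective ι fun X Y hXY => ?_
  have h1 := congrArg (fun F : FK.FStrip => F.obj v) hXY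
  simp only [ι, Function.update_self] at h1
  exact Subtype.ext h1

/-- **IUTchI:Def5.2(i)** (kurims p.134) Conversely, infinitely many `ℱ`-prime-strips force the product of the ambient object
types `∏_v FAmb v` to be infinite (so, with finitely many places, SOME ambient category has infinitely many objects).
[claim: Mochizuki2012, status: disputed] -/
theorem infinite_pi_of_infinite (h : Infinite FK.FStrip) : Infinite (∀ v, FK.FAmb v) :=
  haveI := h
  Infinite.of_injective _ obj_injective

/-- **IUTchI:Def5.2(i)** (kurims p.134) With finitely many places, infinitely many `ℱ`-prime-strips force infinitely many objects
in the ambient category at SOME place. [claim: Mochizuki2012, status: disputed] -/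
theorem exists_infinite_amb_of_infinite [Finite K.V] (h : Infinite FK.FStrip) : ∃ v, Infinite (FK.FAmb v) := by
  by_contra hne
  haveI : ∀ v, Finite (FK.FAmb v) := fun v => not_infinite_iff_finite.mp fun hv => hne ⟨v, hv⟩
  haveI := h
  haveI : Finite FK.FStrip := finite_of_finite
  exact not_finite FK.FStrip

end Literature.IUT.HodgeTheaters.PMBaseKit.FKit.FStrip

/-! ### 2. `𝒟^⊢`-prime-strips and `𝒟-Θ^{±ell}`-Hodge theaters of ANY kit exist ([IUTchI] Def 4.1 (iv), Def 6.4 (iii)) -/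

namespace Literature.IUT.HodgeTheaters.PMBaseKit.MultKit

variable {l : ℕ} {K : PMBaseKit.{u} l}

/-- **IUTchI:Def4.1(iv)** (kurims p.96) Every multiplicative kit has a `𝒟^⊢`-prime-strip: the mono-analyticisation `†𝔇 ↦ †𝔇^⊢` of the
tautological `𝒟`-prime-strip `{𝒟_v}_{v∈𝕍}` ([IUTchI] Ex 6.2 (i) p.160, abc-iut-L5-t4's `DStrip.model`).
[claim: Mochizuki2012, status: disputed] -/
theorem nonempty_dMono (M : K.MultKit) : Nonempty M.DMono := ⟨M.mono (DStrip.model K)⟩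

end Literature.IUT.HodgeTheaters.PMBaseKit.MultKit

namespace Literature.IUT.LogThetaLattice

open CategoryTheory
open Literature.IUT.HodgeTheaters Literature.IUT.HodgeTheaters.PMBaseKit

/-- **IUTchI:Def6.4(iii)** (kurims p.163) The representative-level groupoid `DHTRep K` of `𝒟-Θ^{±ell}`-Hodge theaters of ANY kit (with
`l ≠ 0`) has an object: the model theater `(𝔇_≻ ⟵ 𝔇_± ⟶ 𝒟^{⊚±})` of [IUTchI] Examples 6.2 (i), 6.3 (i) (abc-iut-L5-t4's `Ex62.ht`).
[claim: Mochizuki2012, status: disputed] -/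
theorem DHTRep.nonempty {l : ℕ} [NeZero l] (K : PMBaseKit.{u} l) : Nonempty (DHTRep K) := ⟨DHTRep.of (Ex62.ht K)⟩

section OfKits

variable {l : ℕ} {K : PMBaseKit.{u} l} {M : K.MultKit} {FK : K.FKit M} (L : FK.MonoLaws)
  (hbij : FK.IsomFtoDBijective) (hsurj : FK.IsomFmtoDmSurjective) (hR : FK.RlfOfIsStrip) (X : TimesMuSide FK L)

/-! ### 3. `FrobeniusChain` at `StripFrame.ofKits` ([IUTchIII] Prop 1.2 (x)) -/

/-- **IUTchIII:Prop1.2(x)** (kurims p.34) At the frame ASSEMBLED FROM THE KITS, a Frobenius-picture chain `{ⁿ𝔉}_{n∈ℤ}` of DISTINCT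
`ℱ`-prime-strips exists iff abc-iut-L5-t4's kit has infinitely many `ℱ`-prime-strips (abc-iut-w5-d197's criterion
`nonempty_iff_of_F_eq_asSmall` instantiated by `rfl`: `(StripFrame.ofKits …).F = AsSmall FK.FStrip`).
[claim: Mochizuki2012, status: disputed] -/
theorem FrobeniusChain.nonempty_ofKits_iff :
    Nonempty (FrobeniusChain (StripFrame.ofKits L hbij hsurj hR X)) ↔ Infinite FK.FStrip :=
  FrobeniusChain.nonempty_iff_of_F_eq_asSmall (StripFrame.ofKits_F L hbij hsurj hR X)

/-- **IUTchIII:Prop1.2(x)** (kurims p.34) NEGATIVE half at `ofKits`: over a kit with finitely many places and finitely many objects in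
every ambient category `FAmb v`, the assembled frame carries NO Frobenius-picture chain. [claim: Mochizuki2012, status: disputed] -/
theorem FrobeniusChain.isEmpty_ofKits_of_finite [Finite K.V] [∀ v, Finite (FK.FAmb v)] :
    IsEmpty (FrobeniusChain (StripFrame.ofKits L hbij hsurj hR X)) := by
  haveI : Finite FK.FStrip := FKit.FStrip.finite_of_finite
  exact ⟨fun P =>
    haveI := (FrobeniusChain.nonempty_ofKits_iff L hbij hsurj hR X).1 ⟨P⟩
    not_finite FK.FStrip⟩

/-- **IUTchIII:Prop1.2(x)** (kurims p.34) POSITIVE half at `ofKits`: one place whose ambient category holds infinitely many isomorphs of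
the model `ℱ_v` gives the assembled frame a Frobenius-picture chain. [claim: Mochizuki2012, status: disputed] -/
theorem FrobeniusChain.nonempty_ofKits_of_place (v : K.V)
    (h : Infinite {Y : FK.FAmb v // Nonempty (Y ≅ FK.fModel v)}) :
    Nonempty (FrobeniusChain (StripFrame.ofKits L hbij hsurj hR X)) :=
  (FrobeniusChain.nonempty_ofKits_iff L hbij hsurj hR X).2 (FKit.FStrip.infinite_of_place v h)

/-- **IUTchIII:Prop1.2(x)** (kurims p.34) … and then the chain's full log-links `ⁿ𝔉 --log--> ⁿ⁺¹𝔉` for abc-iut-L6-t3's `LogStripData.ofKits`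
(any kit-level log-Frobenius datum `Lk : LogKit FK`) induce the FULL `𝒟`-poly-isomorphisms with nonempty core (landed
`inducedD_link_full`, `core_nonempty_iso`) — Prop 1.2 (x)'s data instantiated at the assembled frame under the one-place
hypothesis. [claim: Mochizuki2012, status: disputed] -/
theorem FrobeniusChain.link_instantiated_ofKits_of_place (Lk : LogKit FK) (v : K.V)
    (h : Infinite {Y : FK.FAmb v // Nonempty (Y ≅ FK.fModel v)}) :
    ∃ P : FrobeniusChain (StripFrame.ofKits L hbij hsurj hR X),
      (∀ n : ℤ, (P.link (LogStripData.ofKits L hbij hsurj hR X Lk) n).inducedD = PolyIso.full _ _) ∧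
        ∀ n m : ℤ, Nonempty ((StripFrame.ofKits L hbij hsurj hR X).toD.obj (P.F n) ≅
          (StripFrame.ofKits L hbij hsurj hR X).toD.obj (P.F m)) := by
  obtain ⟨P⟩ := FrobeniusChain.nonempty_ofKits_of_place L hbij hsurj hR X v h
  exact ⟨P, P.inducedD_link_full _, P.core_nonempty_iso⟩

/-! ### 4. `Coric` at `StripFrame.ofKits` ([IUTchIII] Cor 2.3) — unconditional -/

/-- **IUTchIII:Cor2.3** (kurims p.73) At the frame ASSEMBLED FROM THE KITS, for EVERY `ThetaCoricData E`, the coric-data interface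
`Coric E = (a_ℭ) †𝔇^⊢` is inhabited: the kit always has a `𝒟^⊢`-prime-strip (`MultKit.nonempty_dMono`, the mono-analyticisation
of the tautological `𝒟`-prime-strip). abc-iut-w5-d197's criterion `Coric.nonempty_iff_of_dv_eq_asSmall` DECIDED positively,
with no kit hypothesis re-bound. [claim: Mochizuki2012, status: disputed] -/
theorem Coric.nonempty_ofKits (E : ThetaCoricData (StripFrame.ofKits L hbij hsurj hR X)) : Nonempty (Coric E) :=
  (Coric.nonempty_iff_of_dv_eq_asSmall E rfl).2 (MultKit.nonempty_dMono M)

/-- **IUTchIII:Cor2.3** (kurims p.73) In particular for abc-iut-L6-t3's `ThetaCoricData.ofKits` (the Cor 2.3 input interface read off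
a kit-level `ThetaCoricKit`, `LatticeGlueOfKits.lean`): its coric data exist. [claim: Mochizuki2012, status: disputed] -/
theorem Coric.nonempty_ofKits_coricKit (Ck : ThetaCoricKit X) :
    Nonempty (Coric (ThetaCoricData.ofKits L hbij hsurj hR X Ck)) :=
  Coric.nonempty_ofKits L hbij hsurj hR X _

/-- **IUTchI:Def6.4(iii)** (kurims p.163) The `𝒟`-`Θ^{±ell}NF`-Hodge theaters of the assembled frame exist (for `l ≠ 0`): the model theater
of [IUTchI] Examples 6.2/6.3 (`Ex62.ht`), as a small object of `AsSmall (DHTRep K)`. [claim: Mochizuki2012, status: disputed] -/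
theorem StripFrame.nonempty_DHT_ofKits [NeZero l] : Nonempty (StripFrame.ofKits L hbij hsurj hR X).DHT :=
  ⟨AsSmall.up.obj (DHTRep.of (Ex62.ht K))⟩

/-- **IUTchIII:Cor2.3** (kurims p.72) At the assembled frame (for `l ≠ 0`) every `ThetaCoricData E` has a RADIAL datum `†ℜ` ((a_ℜ) = a
`𝒟`-`Θ^{±ell}NF`-Hodge theater; (b_ℜ)–(d_ℜ) computed from it). [claim: Mochizuki2012, status: disputed] -/
theorem Radial.nonempty_ofKits [NeZero l] (E : ThetaCoricData (StripFrame.ofKits L hbij hsurj hR X)) :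
    Nonempty (Radial E) :=
  ⟨⟨Classical.choice (StripFrame.nonempty_DHT_ofKits L hbij hsurj hR X)⟩⟩

/-- **IUTchIII:Cor2.3** (kurims p.72) A radial datum has a morphism of radial data (the identity: (a_{Morℜ}) `id`, (d_{Morℜ}) `id`) — the
census row «Radial.Hom» at any frame. [claim: Mochizuki2012, status: disputed] -/
theorem Radial.hom_nonempty {S : StripFrame.{u}} {E : ThetaCoricData S} (R : Radial E) : Nonempty (Radial.Hom R R) :=
  ⟨𝟙 R⟩

/-- **IUTchIII:Cor2.3** (kurims p.72) At the assembled frame (for `l ≠ 0`), for every `ThetaCoricData E`, morphisms of radial data exist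
(census row «Radial.Hom» at `ofKits`). [claim: Mochizuki2012, status: disputed] -/
theorem Radial.exists_hom_ofKits [NeZero l] (E : ThetaCoricData (StripFrame.ofKits L hbij hsurj hR X)) :
    ∃ R : Radial E, Nonempty (Radial.Hom R R) := by
  obtain ⟨R⟩ := Radial.nonempty_ofKits L hbij hsurj hR X E
  exact ⟨R, Radial.hom_nonempty R⟩

/-- **IUTchIII:Cor2.3** (kurims p.73) At the assembled frame, for every `ThetaCoricData E`, morphisms of coric data exist between ANY two
coric data (abc-iut-w5-d197's `Coric.hom_nonempty'`, instantiated; census row «Coric.Hom» at `ofKits`). [claim: Mochizuki2012, status: disputed] -/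
theorem Coric.exists_hom_ofKits (E : ThetaCoricData (StripFrame.ofKits L hbij hsurj hR X)) :
    ∃ C : Coric E, ∀ C' : Coric E, Nonempty (Coric.Hom C C') := by
  obtain ⟨C⟩ := Coric.nonempty_ofKits L hbij hsurj hR X E
  exact ⟨C, fun C' => Coric.hom_nonempty' E C C'⟩

/-- **IUTchIII:Cor2.3** (kurims p.73) … hence the PRINTED producer of coric data, the radial algorithm `†ℜ ↦ †ℭ` (landed functor
`radialAlgorithm E`), has an input at the assembled frame: `Coric E` is inhabited through Cor 2.3's own route (for `l ≠ 0`).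
[claim: Mochizuki2012, status: disputed] -/
theorem Coric.nonempty_ofKits_of_radial [NeZero l] (E : ThetaCoricData (StripFrame.ofKits L hbij hsurj hR X)) :
    Nonempty (Coric E) :=
  haveI := StripFrame.nonempty_DHT_ofKits L hbij hsurj hR X
  Coric.nonempty_of_nonempty_DHT E

/-- **IUTchIII:Cor2.3(i)** (kurims p.73) … and Cor 2.3 (i)'s essential surjectivity is instantiated at the assembled frame: every coric
datum over `ofKits` is isomorphic to one produced by the radial algorithm (landed `radialAlgorithm_essSurj`; for `l ≠ 0`).
[claim: Mochizuki2012, status: disputed] -/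
theorem Coric.exists_iso_radialAlgorithm_obj_ofKits [NeZero l]
    (E : ThetaCoricData (StripFrame.ofKits L hbij hsurj hR X)) (C : Coric E) :
    ∃ R : Radial E, Nonempty ((radialAlgorithm E).obj R ≅ C) :=
  haveI := StripFrame.nonempty_DHT_ofKits L hbij hsurj hR X
  Coric.exists_iso_radialAlgorithm_obj E C

end OfKits

/-! ### 5. THE DECISION at the landed concrete kit: abc-iut-L5-t4's toy kit `FKit.toy l hl` / abc-iut-L6-t3's toy frame -/

namespace KitsToy

/-- **IUTchI:Def5.2(i)** (kurims p.134) In the toy kit (one place; ambient category the collage category `Model.Obj l = {loc, glob}` with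
`Hom(glob, loc) = ∅`) the object `glob` is NOT an isomorph of the model `loc`. (toy-model plumbing, [IUTchI] Def 6.1 p.156)
[claim: Mochizuki2012, status: disputed] -/
theorem not_nonempty_iso_glob_loc (l : ℕ) : ¬ Nonempty ((Model.Obj.glob : Model.Obj l) ≅ Model.Obj.loc) :=
  fun ⟨φ⟩ => (φ.hom : PEmpty).elim

variable (l : ℕ) [Fact l.Prime] (hl : l ≠ 2)

/-- **IUTchI:Def5.2(i)** (kurims p.134) Every `ℱ`-prime-strip of the toy kit IS the model strip constituent-wise: `‡ℱ_v = loc` at the one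
place (the only isomorph of `loc` in `{loc, glob}` is `loc`). [claim: Mochizuki2012, status: disputed] -/
theorem fStrip_obj_eq_loc (F : (FKit.toy l hl).FStrip) (v : (toyKit l hl).V) : F.obj v = Model.Obj.loc := by
  have hF : Nonempty (F.obj v ≅ Model.Obj.loc) := F.isModel v
  revert hF
  change ∀ _ : Nonempty ((F.obj v : Model.Obj l) ≅ (Model.Obj.loc : Model.Obj l)), (F.obj v : Model.Obj l) = Model.Obj.loc
  generalize (F.obj v : Model.Obj l) = x
  cases x with
  | loc => intro; rfl
  | glob => intro h; exact (not_nonempty_iso_glob_loc l h).elim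

/-- **IUTchI:Def5.2(i)** (kurims p.134) The toy kit has exactly one `ℱ`-prime-strip up to equality (`Subsingleton`; it is inhabited by the
model strip, `StripFrameOfKitsToy` `KitsToy.nonempty_F`). DISCLOSED TRUNCATION of the toy: in print the isomorphs of `ℱ_v` form a
proper class. [claim: Mochizuki2012, status: disputed] -/
theorem subsingleton_fStrip : Subsingleton (FKit.toy l hl).FStrip :=
  ⟨fun F₁ F₂ => FKit.FStrip.ext_obj (funext fun v => by rw [fStrip_obj_eq_loc l hl F₁ v, fStrip_obj_eq_loc l hl F₂ v])⟩

/-- **IUTchI:Def5.2(i)** (kurims p.134) … so the toy kit has finitely many `ℱ`-prime-strips. [claim: Mochizuki2012, status: disputed] -/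
theorem finite_fStrip : Finite (FKit.toy l hl).FStrip :=
  haveI := subsingleton_fStrip l hl
  Finite.of_subsingleton

/-- **IUTchI:Def5.2(i)** (kurims p.134) … and NOT infinitely many. [claim: Mochizuki2012, status: disputed] -/
theorem not_infinite_fStrip : ¬ Infinite (FKit.toy l hl).FStrip :=
  haveI := finite_fStrip l hl
  not_infinite_iff_finite.mpr ‹_›

/-- **IUTchIII:Prop1.2(x)** (kurims p.34) **THE DECISION (negative)**: abc-iut-L6-t3's toy frame `KitsToy.frame l hl = StripFrame.ofKits …`
over abc-iut-L5-t4's toy kits — the one `StripFrame.ofKits` instance in the tree — carries NO Frobenius-picture chain of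
DISTINCT `ℱ`-prime-strips (it has a single `ℱ`-prime-strip). Consequently the theorems of `LogLink.lean` quantified over
`P : FrobeniusChain S` are, at `ofKits`, instantiated at NO landed kit; they are instantiated at abc-iut-w5-d197's degenerate
`ℤ`-labelled frame (`FrobeniusChain.nonempty_degenerate`) only. A truncation of the toy, not a finding about the series.
[claim: Mochizuki2012, status: disputed] -/
theorem isEmpty_frobeniusChain : IsEmpty (FrobeniusChain (frame l hl)) :=
  ⟨fun P => not_infinite_fStrip l hl ((FrobeniusChain.nonempty_ofKits_iff _ _ _ _ _).1 ⟨P⟩)⟩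

/-- **IUTchIII:Prop1.2(x)** (kurims p.34) Equivalently: `¬ Nonempty (FrobeniusChain (KitsToy.frame l hl))`. [claim: Mochizuki2012, status: disputed] -/
theorem not_nonempty_frobeniusChain : ¬ Nonempty (FrobeniusChain (frame l hl)) :=
  not_nonempty_iff.mpr (isEmpty_frobeniusChain l hl)

/-- **IUTchIII:Cor2.3** (kurims p.73) At the toy frame, for every `ThetaCoricData`, coric data exist (instance of `Coric.nonempty_ofKits`).
[claim: Mochizuki2012, status: disputed] -/
theorem nonempty_coric (E : ThetaCoricData (frame l hl)) : Nonempty (Coric E) :=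
  Coric.nonempty_ofKits _ _ _ _ _ E

/-- **IUTchIII:Cor2.3** (kurims p.72) At the toy frame, for every `ThetaCoricData`, radial data exist (the prime `l` is nonzero).
[claim: Mochizuki2012, status: disputed] -/
theorem nonempty_radial (E : ThetaCoricData (frame l hl)) : Nonempty (Radial E) :=
  haveI : NeZero l := ⟨(Fact.out : l.Prime).ne_zero⟩
  Radial.nonempty_ofKits _ _ _ _ _ E

end KitsToy

end Literature.IUT.LogThetaLattice
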